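import Summits.BirchSwinnertonDyer.Rank1Residual.X4.OldShapeOfIhara
import Literature.NumberTheory.EllipticCurves.PAdicLFunctionDistributionProofs
import Literature.NumberTheory.EllipticCurves.PAdicLFunctionDistributionHoldsProofs
import HarnessLib

/-!
# The mod-`p` plus functional of a rational newform on the dual space `S₂(Γ₀(N))^∨` (cell `b2b-bsdres`, seat additive-p4, line V45)

HONEST FRAMING (verbatim, cell `b2b-bsdres`): the goal of the cell is to DELETE the COMBINATION-SHAPED
residual classes for ALL analytic-rank `≤ 1` curves over `ℚ` — "full BSD formula for every rank `≤ 1`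
curve in class `C`" assembled STRICTLY from published theorems — so that the rank-`≤ 1` remainder
becomes exactly the CONSTRUCTION-SHAPED classes, which are TYPED (missing-input Props), NOT attempted;
this is not "finishing BSD". This file: ONE TOOL theorem (modular symbols), 0 defs, 0 facts, nothing
booked; X4 CONSTRUCTION-SHAPED.

## What is proved

`exists_plusFunctional`: for a normalised newform `f ∈ S₂(Γ₀(N))` with rational coefficients whose
plus symbols `[r]⁺_f` are all `p`-integral, with integer eigenvalues `θ(q) = a_q(f)` at the primes,
there are an additive subgroup `P ⊆ S₂(Γ₀(N))^∨` and a function `Ψ : S₂(Γ₀(N))^∨ → 𝔽_p` such that: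
`P` contains every symbol functional `{∞, r}` (`σ r`, `h ↦ {∞, r}_h`) and the period homology
`H₁(X₀(N), ℤ)`, is stable under every `T_q ∈ 𝕋_ℤ` (`q` prime; `U_q` for `q ∣ N`), `Ψ` is ADDITIVE on
`P`, `Ψ({∞, r}) = [r]⁺_f mod p`, and `Ψ(T_q • z) = θ(q) Ψ(z)` on `P`. CONSTRUCTION (inside the proof,
no definition is made): `P = {z : re z(f)/Ω⁺_f is a p-integral rational}`,
`Ψ(z) = (that rational) mod p` — by `plusSymbol f r = re {∞, r}_f` (real coefficients,
`plusSymbol_eq_re_holds`), `(ratPlusSymbol f r : ℝ) = re(plusSymbol f r)/Ω⁺_f`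
(`ratCast_ratPlusSymbol_holds`, Manin–Drinfeld), and `(T_q • z)(f) = z(T_q f) = a_q(f) z(f)`. This is
the object "`φ̄_f` read on `H₁(X₀(N), ℤ)` AND on paths" that V45's Mazur-principle chain
(`X4/LevelLoweringOfOldOnCycles`) transports from cycles to paths.

## References

* B. Mazur, J. Tate, J. Teitelbaum, Invent. Math. 84 (1986), §I.4 (4.2), §I.8. [cite: MazurTateTeitelbaum1986Invent, §I.4 (4.2) and §I.8]
* J. E. Cremona, *Algorithms for modular elliptic curves* (1997), §2.1, §2.8. [cite: CremonaAlgorithms1997, §2.8]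
* Ju. I. Manin, Izv. Akad. Nauk SSSR 36 (1972), Cor. 3.6 (Manin–Drinfeld). [cite: Manin1972, Cor. 3.6]
-/

noncomputable section

open scoped MatrixGroups ModularForm

open CongruenceSubgroup Finset Matrix

open Literature.NumberTheory.EllipticCurves Literature.NumberTheory.EllipticCurves.ModularForms
  Literature.NumberTheory.EllipticCurves.ModularForms.HidaCohomology

namespace Summit.BirchSwinnertonDyer.Rank1Residual.LevelLowering

section PlusFunctional

variable {p : ℕ} [hp : Fact p.Prime] {N : ℕ} [NeZero N]

/-- The denominator of a sum of `p`-integral rationals is prime to `p`. [folklore] -/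
private theorem not_dvd_den_add' {a b : ℚ} (ha : ¬ p ∣ a.den) (hb : ¬ p ∣ b.den) :
    ¬ p ∣ (a + b).den := by
  intro h
  rcases (Nat.Prime.dvd_mul hp.out).mp (dvd_trans h (Rat.add_den_dvd a b)) with h1 | h2
  · exact ha h1
  · exact hb h2

/-- The denominator of a product of `p`-integral rationals is prime to `p`. [folklore] -/
private theorem not_dvd_den_mul' {a b : ℚ} (ha : ¬ p ∣ a.den) (hb : ¬ p ∣ b.den) :
    ¬ p ∣ (a * b).den := by
  intro h
  rcases (Nat.Prime.dvd_mul hp.out).mp (dvd_trans h (Rat.mul_den_dvd a b)) with h1 | h2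
  · exact ha h1
  · exact hb h2

/-- Casting a sum of `p`-integral rationals to `ℤ/p`. [folklore] -/
private theorem ratCast_add_of_not_dvd' {a b : ℚ} (ha : ¬ p ∣ a.den) (hb : ¬ p ∣ b.den) :
    ((a + b : ℚ) : ZMod p) = (a : ZMod p) + (b : ZMod p) := by
  have ha' : (a.den : ZMod p) ≠ 0 := by rwa [Ne, ZMod.natCast_eq_zero_iff]
  have hb' : (b.den : ZMod p) ≠ 0 := by rwa [Ne, ZMod.natCast_eq_zero_iff]
  exact Rat.cast_add_of_ne_zero ha' hb'

/-- Casting an integer multiple of a `p`-integral rational to `ℤ/p`. [folklore] -/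
private theorem ratCast_intCast_mul_of_not_dvd' (n : ℤ) {a : ℚ} (ha : ¬ p ∣ a.den) :
    (((n : ℚ) * a : ℚ) : ZMod p) = (n : ZMod p) * (a : ZMod p) := by
  have ha' : (a.den : ZMod p) ≠ 0 := by rwa [Ne, ZMod.natCast_eq_zero_iff]
  have hn' : ((n : ℚ).den : ZMod p) ≠ 0 := by rw [Rat.den_intCast, Nat.cast_one]; exact one_ne_zero
  rw [Rat.cast_mul_of_ne_zero hn' ha', Rat.cast_intCast]

/-- **THE MOD-`p` PLUS FUNCTIONAL OF A RATIONAL NEWFORM ON `S₂(Γ₀(N))^∨`.** See the module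
docstring: an additive subgroup `P ∋ {∞, r}, ⊇ H₁(X₀(N), ℤ)`, `T_q`-stable, and `Ψ : S₂^∨ → 𝔽_p`
additive on `P` with `Ψ({∞, r}) = [r]⁺_f mod p` and `Ψ(T_q • z) = a_q(f) Ψ(z)` on `P` (every prime
`q`; `T_q = U_q` for `q ∣ N`). Here `σ r` is any realisation of the symbol functional `h ↦ {∞, r}_h`
(hypothesis `hσ`). [cite: MazurTateTeitelbaum1986Invent, §I.4 (4.2) and §I.8]
[cite: CremonaAlgorithms1997, §2.8] [cite: Manin1972, Cor. 3.6] -/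
theorem exists_plusFunctional (f : CuspForm (Gamma0 N) 2) (hf : IsNewform0 f) (hQ : coeffField f = ⊥)
    (hint : ∀ r : ℚ, ¬ p ∣ (ratPlusSymbol f r).den)
    (θ : ℕ → ℤ) (hθ : ∀ q : ℕ, q.Prime → ((θ q : ℤ) : ℂ) = cuspCoeff f q)
    (σ : ℚ → Module.Dual ℂ (CuspForm (Gamma0 N) 2))
    (hσ : ∀ (r : ℚ) (h : CuspForm (Gamma0 N) 2), σ r h = modularSymbol h r) :
    ∃ (P : AddSubgroup (Module.Dual ℂ (CuspForm (Gamma0 N) 2)))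
      (Ψ : Module.Dual ℂ (CuspForm (Gamma0 N) 2) → ZMod p),
      (∀ r : ℚ, σ r ∈ P) ∧ periodHomology N ≤ P ∧
      (∀ (q : ℕ) (hq : q.Prime), ∀ z ∈ P, HeckeRing0.T N 2 q hq • z ∈ P) ∧
      (∀ x ∈ P, ∀ y ∈ P, Ψ (x + y) = Ψ x + Ψ y) ∧
      (∀ r : ℚ, Ψ (σ r) = ((ratPlusSymbol f r : ℚ) : ZMod p)) ∧
      ∀ (q : ℕ) (hq : q.Prime), ∀ z ∈ P, Ψ (HeckeRing0.T N 2 q hq • z) = (θ q : ZMod p) * Ψ z := by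
  classical
  -- the value `v z = re z(f) / Ω⁺_f` and its rational preimage
  obtain ⟨v, hv⟩ : ∃ v : Module.Dual ℂ (CuspForm (Gamma0 N) 2) → ℝ,
      ∀ z, v z = (z f).re / plusPeriod f := ⟨_, fun _ ↦ rfl⟩
  have hv_add : ∀ x y, v (x + y) = v x + v y := fun x y ↦ by
    rw [hv, hv, hv, LinearMap.add_apply, Complex.add_re, add_div]
  have hv_T : ∀ (q : ℕ) (hq : q.Prime) (z : Module.Dual ℂ (CuspForm (Gamma0 N) 2)),
      v (HeckeRing0.T N 2 q hq • z) = (θ q : ℝ) * v z := by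
    intro q hq z
    haveI : NeZero q := ⟨hq.ne_zero⟩
    have hT : HeckeRing0.toEnd N 2 (HeckeRing0.T N 2 q hq) f = ((θ q : ℤ) : ℂ) • f := by
      rw [HeckeRing0.toEnd_T, hf.heckeT_eq_coeff_smul hq]
      exact congrArg (· • f) (hθ q hq).symm
    rw [hv, hv, HeckeRing0.smul_dual_apply, hT, map_smul, smul_eq_mul,
      show ((θ q : ℤ) : ℂ) = ((θ q : ℝ) : ℂ) by norm_cast, Complex.re_ofReal_mul, mul_div_assoc]
  -- the symbol functionals have the rational `p`-integral values `[r]⁺_f`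
  have hv_σ : ∀ r : ℚ, v (σ r) = (ratPlusSymbol f r : ℝ) := fun r ↦ by
    rw [hv, hσ, ratCast_ratPlusSymbol_holds hf hQ r, normalizedPlusSymbol,
      plusSymbol_eq_re_holds f hf.cuspCoeff_im_eq_zero r, Complex.ofReal_re]
  -- `P = {z : v z is a p-integral rational}`
  let P : AddSubgroup (Module.Dual ℂ (CuspForm (Gamma0 N) 2)) :=
    { carrier := {z | ∃ x : ℚ, ¬ p ∣ x.den ∧ v z = x}
      zero_mem' := ⟨0, by
        rw [Rat.den_zero]; exact fun h ↦ hp.out.one_lt.ne' (Nat.dvd_one.mp h), by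
        rw [hv, LinearMap.zero_apply, Complex.zero_re, zero_div, Rat.cast_zero]⟩
      add_mem' := by
        rintro x y ⟨a, ha, hxa⟩ ⟨b, hb, hyb⟩
        exact ⟨a + b, not_dvd_den_add' ha hb, by rw [hv_add, hxa, hyb, Rat.cast_add]⟩
      neg_mem' := by
        rintro x ⟨a, ha, hxa⟩
        refine ⟨-a, by rwa [Rat.den_neg_eq_den], ?_⟩
        have h := hv_add x (-x)
        rw [add_neg_cancel, hv, LinearMap.zero_apply, Complex.zero_re, zero_div] at h
        rw [Rat.cast_neg, ← hxa]
        linarith }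
  have hP : ∀ z, z ∈ P ↔ ∃ x : ℚ, ¬ p ∣ x.den ∧ v z = x := fun z ↦ Iff.rfl
  -- `Ψ z = (rational value of v z) mod p`
  obtain ⟨Ψ, hΨ⟩ : ∃ Ψ : Module.Dual ℂ (CuspForm (Gamma0 N) 2) → ZMod p,
      ∀ z, Ψ z = ((Function.invFun ((↑) : ℚ → ℝ) (v z) : ℚ) : ZMod p) := ⟨_, fun _ ↦ rfl⟩
  have hinv : ∀ x : ℚ, Function.invFun ((↑) : ℚ → ℝ) (x : ℝ) = x :=
    Function.leftInverse_invFun Rat.cast_injective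
  have hΨv : ∀ z (x : ℚ), v z = x → Ψ z = (x : ZMod p) := fun z x h ↦ by
    rw [hΨ, h, hinv]
  have hσP : ∀ r : ℚ, σ r ∈ P := fun r ↦ (hP _).mpr ⟨ratPlusSymbol f r, hint r, hv_σ r⟩
  have hTP : ∀ (q : ℕ) (hq : q.Prime), ∀ z ∈ P, HeckeRing0.T N 2 q hq • z ∈ P := by
    intro q hq z hz
    obtain ⟨x, hx, hzx⟩ := (hP z).mp hz
    refine (hP _).mpr ⟨(θ q : ℚ) * x, not_dvd_den_mul' (by
      rw [Rat.den_intCast]; exact fun h ↦ hp.out.one_lt.ne' (Nat.dvd_one.mp h)) hx, ?_⟩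
    rw [hv_T q hq z, hzx]
    push_cast
    ring
  refine ⟨P, Ψ, hσP, ?_, hTP, ?_, fun r ↦ hΨv _ _ (hv_σ r), ?_⟩
  · -- `H₁(X₀(N), ℤ) ≤ P`: every period functional is a symbol functional (or `0`)
    rw [periodHomology, AddSubgroup.closure_le]
    rintro _ ⟨γ, rfl⟩
    by_cases hc : (γ : SL(2, ℤ)) 1 0 = 0
    · rw [periodFunctional_eq_zero_of_apply_eq_zero γ hc]
      exact P.zero_mem
    · have e : periodFunctional N γ =
          σ ((((γ : SL(2, ℤ)) 0 0 : ℤ) : ℚ) / (((γ : SL(2, ℤ)) 1 0 : ℤ) : ℚ)) := by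
        ext h
        rw [periodFunctional_apply, cuspSymbol, if_neg hc, hσ]
      rw [SetLike.mem_coe, e]
      exact hσP _
  · -- additivity on `P`
    intro x hx y hy
    obtain ⟨a, ha, hxa⟩ := (hP x).mp hx
    obtain ⟨b, hb, hyb⟩ := (hP y).mp hy
    rw [hΨv x a hxa, hΨv y b hyb, hΨv (x + y) (a + b) (by rw [hv_add, hxa, hyb, Rat.cast_add]),
      ratCast_add_of_not_dvd' ha hb]
  · -- Hecke
    intro q hq z hz
    obtain ⟨x, hx, hzx⟩ := (hP z).mp hz
    rw [hΨv z x hzx, hΨv _ ((θ q : ℚ) * x) (by rw [hv_T q hq z, hzx]; push_cast; ring),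
      ratCast_intCast_mul_of_not_dvd' _ hx]

end PlusFunctional

end Summit.BirchSwinnertonDyer.Rank1Residual.LevelLowering

end
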